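import Literature.MathematicalPhysics.QuantumFieldTheory.Balaban1983to89.T4GenFunBounds
import Summits.QuantumFields.YangMills.Theorems.EquipartitionCriticalityEquipartitionPinsProbeTangentDiffIdentity
import Summits.QuantumFields.YangMills.Theorems.EquipartitionCriticalityEquipartitionPinsProbeTangentSteinPrelim
import HarnessLib

/-!
# The one-bond Haar shift and the one-bond Schwinger–Dyson (integration-by-parts) identity for Bałaban's unit-scale
# Gibbs measure `T4GenFunBounds.gibbsMeasure P β` (hence for `T3UnitScaleTilt.gibbsK`)

Crux of record `UnitScaleTilt.HistoryTailL` (stmt-QuantumFields-19936), cell `ym3-torus` (YM ladder rung R3 = continuum SU(2)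
Yang–Mills on T³ — a RUNG, NOT the Clay problem: not d = 4, not infinite volume, not a mass gap); twin-width seat
`ym-ust-19936-w8` gen 9.  Infrastructure BRIDGE asked for by the crux idea «gross-sd-transfer» (LINE 28 candidate,
`Cruxes/HistoryTailL/Ideas/gross-sd-transfer.md`, annexes 1–2: definition need D1) — the tree's one-link Haar-shift ∕
Schwinger–Dyson identity (✓ `…CurvatureAmnesia.WardDefect.SchwingerDyson.integral_shiftDeriv_eq_wilson` on the torus type
`GaugeConfig d L G`; ✓ `GaugeBoot.TiltedRP.integral_comp_update_mul_gibbs` ∕ `integral_shiftDeriv_eq_gibbs` on periodic lattices)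
RE-RUN ON BAŁABAN'S TYPES `GaugeField P j G = PBond P j → G`, `fieldMeasure P j G = Measure.pi (fun _ => HaarData.haar)`,
`gibbsMeasure P β = Z⁻¹ • (fieldMeasure P 0 G).withDensity e^{−βA}` (`A = wilsonAction4`), for an ABSTRACT gauge group
`[GaugeGroup G] [MeasurableSpace G] [RegularGaugeGroup G] [HaarData G]` — no topology, no matrices: the derivative form is
stated for a multiplicative family `k : ℝ → G` (`k(s+t) = k(s)k(t)`, e.g. `t ↦ exp(t·X)`, `X ∈ 𝔰𝔲(2)`) and observables that are
measurable, bounded and differentiable ALONG THE SHIFT `U ↦ U[b ↦ k(t)·U_b]` with a measurable bounded derivative.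

* §1 the shift `U ↦ U[b ↦ g·U_b]`: it is undone by the shift by `g⁻¹`, composes along `k`, is measurable, and PRESERVES the
  product Haar measure `fieldMeasure` (left invariance `HaarData.map_mul_left` in the factor `b`, Mathlib `measurePreserving_pi`);
  ★ `integral_comp_update_mul_fieldMeasure`.
* §2 ★★ `integral_comp_update_mul_gibbsMeasure` — THE ONE-BOND HAAR-SHIFT (GIBBS ∕ DLR) IDENTITY
  `∫ f(U[b ↦ gU_b]) dμ_β = ∫ f(U)·exp(−β(A(U[b ↦ g⁻¹U_b]) − A(U))) dμ_β` (`β ≥ 0`, every `f`).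
* §3 ★★★ `integral_shiftDeriv_eq_gibbsMeasure` — THE ONE-BOND SCHWINGER–DYSON IDENTITY `∫ f′ dμ_β = β·∫ f·A′ dμ_β`: §2 at
  `g = k(t)` differentiated at `t = 0` under the integral sign on both sides, by the tree's bounded-Lipschitz engine
  ✓ `EquipartitionPinsProbe.TangentDiffIdentity.hasDerivAt_integral_of_bounded_lipschitz` and ✓ `…TangentSteinFiniteBeta.lipschitz_of_flow`.

THEOREMS ONLY (0 `def`, 0 `sorry`, default heartbeats); `--supports stmt-QuantumFields-19936 --as helper`.  `G : Type` (the engine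
lemmas are universe-monomorphic).  HONEST SCOPE.  An exact finite-`β` identity; nothing of (Q), `MeanDeviationShallowL`, K1,
`MeanDeviationL`, `HistoryTailL`, the rung R3, d = 4, a continuum limit or a mass gap is proved here; the Yang–Mills mass gap is
NOT proved.

References: M. Creutz, Quarks, Gluons and Lattices (2nd ed. 2022; 1st ed. 1983) Ch. 11 (invariance of the link integrals) [Creutz2022]; S. Chatterjee,
Rigorous solution of strongly coupled SO(N) lattice gauge theory in the large N limit, CMP 366 (2019) §8 (Schwinger–Dyson ∕
integration by parts on the group) [Chatterjee2019LargeN]; L. Gross, Convergence of U(1)₃ lattice gauge theory to its continuum limit,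
CMP 92 (1983) 137–162, Thm 2.2 (the Schwinger–Dyson proof of Gaussian domination the bridge serves) [GrossCMP1983].
-/

noncomputable section

open MeasureTheory Filter Topology
open Literature.MathematicalPhysics.QuantumFieldTheory.Balaban1983to89
open Literature.MathematicalPhysics.QuantumFieldTheory.Balaban1983to89.Missing
  (boltzmann partitionFn boltzmann_pos partitionFn_pos' measurable_wilsonAction4 isProbabilityMeasure_fieldMeasure)
open Literature.MathematicalPhysics.QuantumFieldTheory.Balaban1983to89.T4GenFunBounds
  (gibbsMeasure integral_gibbsMeasure isProbabilityMeasure_gibbsMeasure)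
open Summit.QuantumFields.YangMills.Theorems.EquipartitionPinsProbe.TangentSteinFiniteBeta
  (lipschitz_of_flow abs_exp_sub_exp_le)
open Summit.QuantumFields.YangMills.Theorems.EquipartitionPinsProbe.TangentDiffIdentity
  (hasDerivAt_integral_of_bounded_lipschitz)

namespace Summit.QuantumFields.YangMills.Theorems.UnitScaleGibbsOneBondSchwingerDyson

variable {P : Params} {G : Type} [GaugeGroup G]

section General

variable {j : ℕ} [DecidableEq (PBond P j)]

/-! ## §1 The one-bond left shift `U ↦ U[b ↦ g·U_b]` -/

/-- The shift by `g⁻¹` undoes the shift by `g`: `(U[b ↦ gU_b])[b ↦ g⁻¹(U[b ↦ gU_b])_b] = U`. [cite: Creutz2022, Ch. 11] -/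
theorem update_inv_mul_update_mul (b : PBond P j) (g : G) (U : GaugeField P j G) :
    Function.update (Function.update U b (g * U b)) b (g⁻¹ * Function.update U b (g * U b) b) = U := by
  funext b'
  by_cases hb : b' = b
  · subst hb; simp
  · simp [hb]

/-- The shift by `g` undoes the shift by `g⁻¹`. [cite: Creutz2022, Ch. 11] -/
theorem update_mul_update_inv_mul (b : PBond P j) (g : G) (U : GaugeField P j G) :
    Function.update (Function.update U b (g⁻¹ * U b)) b (g * Function.update U b (g⁻¹ * U b) b) = U := by
  have h := update_inv_mul_update_mul b g⁻¹ U
  rwa [inv_inv] at h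

/-- Along a multiplicative family `k(s+t) = k(s)k(t)` the shifts compose: `T_{t+s} = T_t ∘ T_s`. [cite: Creutz2022, Ch. 11] -/
theorem update_mul_flow {k : ℝ → G} (hk : ∀ s t, k (s + t) = k s * k t) (b : PBond P j) (s t : ℝ)
    (U : GaugeField P j G) :
    Function.update U b (k (t + s) * U b) =
      Function.update (Function.update U b (k s * U b)) b (k t * Function.update U b (k s * U b) b) := by
  funext b'
  by_cases hb : b' = b
  · subst hb; simp [hk t s, mul_assoc]
  · simp [hb]

/-- A multiplicative family starts at `1`, so `T_0 = id`. [cite: Creutz2022, Ch. 11] -/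
theorem update_mul_zero {k : ℝ → G} (hk : ∀ s t, k (s + t) = k s * k t) (b : PBond P j) (U : GaugeField P j G) :
    Function.update U b (k 0 * U b) = U := by
  have h1 : k 0 = 1 := by
    have h := hk 0 0
    rw [add_zero] at h
    exact mul_eq_left.1 h.symm
  rw [h1, one_mul, Function.update_eq_self]

variable [MeasurableSpace G] [RegularGaugeGroup G]

/-- The one-bond shift is measurable (product σ-algebra; `RegularGaugeGroup` gives measurable multiplication). [cite: Creutz2022, Ch. 11] -/
theorem measurable_update_mul (b : PBond P j) (g : G) :
    Measurable fun U : GaugeField P j G => Function.update U b (g * U b) := by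
  refine measurable_pi_lambda _ fun b' => ?_
  by_cases hb : b' = b
  · subst hb
    simp only [Function.update_self]
    exact ((measurable_pi_apply b' : Measurable fun U : GaugeField P j G => U b')).const_mul g
  · simp only [Function.update_of_ne hb]
    exact measurable_pi_apply b'

omit [DecidableEq (PBond P j)] in
/-- The Wilson action is bounded: `|A(U)| ≤ 2·#plaquettes` (each density `1 − Re tr U(∂p) ∈ [0, 2]`). [cite: Creutz2022, Ch. 11] -/
theorem abs_wilsonAction4_le (U : GaugeField P j G) : |wilsonAction4 U| ≤ 2 * (Fintype.card (Plaq P j) : ℝ) := by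
  rw [abs_of_nonneg (wilsonAction4_nonneg U)]
  unfold wilsonAction4 wilsonAction
  calc ∑ p : Plaq P j, (1 : ℝ) * (1 - reTr (GaugeField.plaqHol U p))
      ≤ ∑ _p : Plaq P j, (2 : ℝ) := Finset.sum_le_sum fun p _ => by
        rw [one_mul]; exact (RegularGaugeGroup.one_sub_reTr_mem_Icc (GaugeField.plaqHol U p)).2
    _ = 2 * (Fintype.card (Plaq P j) : ℝ) := by
        rw [Finset.sum_const, Finset.card_univ, nsmul_eq_mul, mul_comm]

variable [HaarData G]

/-- ★ **THE ONE-BOND SHIFT PRESERVES THE PRODUCT HAAR MEASURE** `fieldMeasure P j G` (left invariance of `HaarData.haar` in the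
factor `b`). [cite: Creutz2022, Ch. 11] -/
theorem measurePreserving_update_mul (b : PBond P j) (g : G) :
    MeasurePreserving (fun U : GaugeField P j G => Function.update U b (g * U b))
      (fieldMeasure P j G) (fieldMeasure P j G) := by
  haveI : IsProbabilityMeasure (HaarData.haar : Measure G) := HaarData.isProb
  have hleft : MeasurePreserving (fun x : G => g * x) (HaarData.haar : Measure G) HaarData.haar :=
    ⟨measurable_const_mul g, HaarData.map_mul_left g⟩
  have key := measurePreserving_pi (fun _ : PBond P j => (HaarData.haar : Measure G))
    (fun _ : PBond P j => (HaarData.haar : Measure G))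
    (f := fun b' (x : G) => if b' = b then g * x else x) (fun b' => by
      by_cases hb : b' = b
      · simp only [hb, ↓reduceIte]; exact hleft
      · simp only [hb, ↓reduceIte]; exact MeasurePreserving.id _)
  have hfun : (fun U : GaugeField P j G => Function.update U b (g * U b)) =
      fun (a : GaugeField P j G) (b' : PBond P j) => (fun (b'' : PBond P j) (x : G) => if b'' = b then g * x else x) b' (a b') := by
    funext U b'
    by_cases hb : b' = b
    · subst hb; simp
    · simp [hb]
  rw [hfun]
  unfold fieldMeasure
  exact key

/-- ★ **CHANGE OF VARIABLES UNDER THE PRODUCT HAAR MEASURE**: `∫ f(U[b ↦ gU_b]) dU = ∫ f(U) dU` for every `f`. [cite: Creutz2022, Ch. 11] -/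
theorem integral_comp_update_mul_fieldMeasure (b : PBond P j) (g : G) (f : GaugeField P j G → ℝ) :
    ∫ U, f (Function.update U b (g * U b)) ∂fieldMeasure P j G = ∫ U, f U ∂fieldMeasure P j G := by
  let T : GaugeField P j G ≃ᵐ GaugeField P j G :=
    { toFun := fun U => Function.update U b (g * U b)
      invFun := fun U => Function.update U b (g⁻¹ * U b)
      left_inv := fun U => update_inv_mul_update_mul b g U
      right_inv := fun U => update_mul_update_inv_mul b g U
      measurable_toFun := measurable_update_mul b g
      measurable_invFun := measurable_update_mul b g⁻¹ }
  have hT : MeasurePreserving T (fieldMeasure P j G) (fieldMeasure P j G) := measurePreserving_update_mul b g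
  exact hT.integral_comp' f

/-- **HAAR CASE (`β = 0` form on the product measure): `∫ f′ dU = 0`** — the derivative at `t = 0` of the invariance
`∫ f(U[b ↦ k(t)U_b]) dU = ∫ f dU` of §1, for `f` measurable bounded with a measurable bounded shift-derivative `f′`; every level `j`.
[cite: Chatterjee2019LargeN, §8] -/
theorem integral_shiftDeriv_eq_zero_fieldMeasure (b : PBond P j) {k : ℝ → G} (hk : ∀ s t, k (s + t) = k s * k t)
    (f f' : GaugeField P j G → ℝ) (hfm : Measurable f) (hf'm : Measurable f') {Cf Cf' : ℝ} (hCf : ∀ U, |f U| ≤ Cf)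
    (hCf' : ∀ U, |f' U| ≤ Cf') (hf' : ∀ U, HasDerivAt (fun t => f (Function.update U b (k t * U b))) (f' U) 0) :
    ∫ U, f' U ∂fieldMeasure P j G = 0 := by
  haveI := isProbabilityMeasure_fieldMeasure (G := G) P j
  set μ := fieldMeasure P j G with hμ
  set T : ℝ → GaugeField P j G → GaugeField P j G := fun t U => Function.update U b (k t * U b) with hT
  have hflow : ∀ s t U, T (t + s) U = T t (T s U) := fun s t U => update_mul_flow hk b s t U
  have hTm : ∀ t, Measurable (T t) := fun t => measurable_update_mul b (k t)
  have hf'T : ∀ U, HasDerivAt (fun t => f (T t U)) (f' U) 0 := hf'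
  have hAB : ∀ t : ℝ, ∫ U, f (T t U) ∂μ = ∫ U, f U ∂μ := fun t => integral_comp_update_mul_fieldMeasure b (k t) f
  have hAd : HasDerivAt (fun t : ℝ => ∫ U, f (T t U) ∂μ) (∫ U, f' U ∂μ) 0 := by
    refine hasDerivAt_integral_of_bounded_lipschitz μ (fun t U => f (T t U)) f' (Cf + Cf')
      (fun t => hfm.comp (hTm t)) hf'm
      (fun t U => (hCf _).trans (le_add_of_nonneg_right ?_)) (fun U t s => ?_) hf'T
    · exact (abs_nonneg _).trans (hCf' U)
    · calc |f (T t U) - f (T s U)| ≤ Cf' * |t - s| := lipschitz_of_flow T hflow f f' hf'T hCf' U t s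
        _ ≤ (Cf + Cf') * |t - s| := by
            gcongr; linarith [(abs_nonneg _).trans (hCf U)]
  have hEq : (fun t : ℝ => ∫ U, f (T t U) ∂μ) = fun _ : ℝ => ∫ U, f U ∂μ := funext hAB
  rw [hEq] at hAd
  exact hAd.unique (hasDerivAt_const (0 : ℝ) _)

end General

section Finest

variable [DecidableEq (PBond P 0)] [MeasurableSpace G] [RegularGaugeGroup G] [HaarData G]

/-! ## §2 The one-bond Haar-shift (Gibbs ∕ DLR) identity -/

/-- ★★ **THE ONE-BOND HAAR-SHIFT IDENTITY OF BAŁABAN'S GIBBS MEASURE** (`β ≥ 0`, every bond `b`, every `g ∈ G`, every `f`):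
`∫ f(U[b ↦ gU_b]) dμ_β = ∫ f(U)·exp(−β(A(U[b ↦ g⁻¹U_b]) − A(U))) dμ_β`, `μ_β = gibbsMeasure P β`, `A = wilsonAction4` — the conditional
law of one bond variable given the others is Haar measure tilted by the Boltzmann weight of the plaquettes through `b`.  Proof: §1's
change of variables in `Z⁻¹∫(·)e^{−βA}dU` and telescoping of the Boltzmann factors. [cite: Creutz2022, Ch. 11] -/
theorem integral_comp_update_mul_gibbsMeasure {β : ℝ} (hβ : 0 ≤ β) (b : PBond P 0) (g : G) (f : GaugeField P 0 G → ℝ) :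
    ∫ U, f (Function.update U b (g * U b)) ∂gibbsMeasure P β =
      ∫ U, f U * Real.exp (-(β * (wilsonAction4 (Function.update U b (g⁻¹ * U b)) - wilsonAction4 U)))
        ∂gibbsMeasure P β := by
  rw [integral_gibbsMeasure P hβ, integral_gibbsMeasure P hβ]
  congr 1
  -- change variables `U ↦ U[b ↦ gU_b]` in the right-hand integral
  have hcv := integral_comp_update_mul_fieldMeasure b g (fun V : GaugeField P 0 G =>
    f V * Real.exp (-(β * (wilsonAction4 (Function.update V b (g⁻¹ * V b)) - wilsonAction4 V))) * boltzmann P β V)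
  rw [← hcv]
  refine integral_congr_ae (ae_of_all _ fun U => ?_)
  show f (Function.update U b (g * U b)) * boltzmann P β U =
    f (Function.update U b (g * U b)) * Real.exp (-(β *
      (wilsonAction4 (Function.update (Function.update U b (g * U b)) b (g⁻¹ * Function.update U b (g * U b) b)) -
        wilsonAction4 (Function.update U b (g * U b))))) * boltzmann P β (Function.update U b (g * U b))
  rw [update_inv_mul_update_mul]
  set S₀ := wilsonAction4 U
  set S₁ := wilsonAction4 (Function.update U b (g * U b))
  have hexp : Real.exp (-(β * (S₀ - S₁))) * Real.exp (-β * S₁) = Real.exp (-β * S₀) := by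
    rw [← Real.exp_add]; congr 1; ring
  unfold boltzmann
  rw [mul_assoc, hexp]

/-- The same identity against a second factor: `∫ f(U[b ↦ gU_b])·h(U) dμ_β = ∫ f(U)·h(U[b ↦ g⁻¹U_b])·exp(−β(A(U[b ↦ g⁻¹U_b]) − A(U))) dμ_β`.
[cite: Creutz2022, Ch. 11] -/
theorem integral_comp_update_mul_mul_gibbsMeasure {β : ℝ} (hβ : 0 ≤ β) (b : PBond P 0) (g : G)
    (f h : GaugeField P 0 G → ℝ) :
    ∫ U, f (Function.update U b (g * U b)) * h U ∂gibbsMeasure P β =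
      ∫ U, f U * h (Function.update U b (g⁻¹ * U b)) *
        Real.exp (-(β * (wilsonAction4 (Function.update U b (g⁻¹ * U b)) - wilsonAction4 U))) ∂gibbsMeasure P β := by
  have h' := integral_comp_update_mul_gibbsMeasure (P := P) hβ b g
    (fun V => f V * h (Function.update V b (g⁻¹ * V b)))
  simp only [update_inv_mul_update_mul] at h'
  exact h'

/-! ## §3 The one-bond Schwinger–Dyson identity -/

/-- ★★★ **THE ONE-BOND SCHWINGER–DYSON (INTEGRATION-BY-PARTS) IDENTITY FOR BAŁABAN'S GIBBS MEASURE.**  Let `β ≥ 0`, `b` a bond of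
the finest lattice, `k : ℝ → G` multiplicative (`k(s+t) = k(s)k(t)`; e.g. `k(t) = exp(tX)`, `X ∈ 𝔰𝔲(2)`).  If the observable `f` is
measurable and bounded, differentiable along the shift `t ↦ U[b ↦ k(t)U_b]` at `t = 0` at every `U` with a measurable bounded derivative
`f′`, and `A′` is a measurable bounded derivative of the Wilson action `A = wilsonAction4` along the same shift, then
`∫ f′ dμ_β = β·∫ f·A′ dμ_β` (`μ_β = gibbsMeasure P β`).  Proof: §2 at `g = k(t)` is an identity between two functions of `t`;
differentiate both at `t = 0` under the integral sign (bounded Lipschitz families, the flow property turning the derivative at `0` into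
a derivative everywhere).  No topology or smooth structure on `G` is used. [cite: Chatterjee2019LargeN, §8; Creutz2022, Ch. 11] -/
theorem integral_shiftDeriv_eq_gibbsMeasure {β : ℝ} (hβ : 0 ≤ β) (b : PBond P 0) {k : ℝ → G}
    (hk : ∀ s t, k (s + t) = k s * k t) (f f' : GaugeField P 0 G → ℝ) (hfm : Measurable f) (hf'm : Measurable f')
    {Cf Cf' : ℝ} (hCf : ∀ U, |f U| ≤ Cf) (hCf' : ∀ U, |f' U| ≤ Cf')
    (hf' : ∀ U, HasDerivAt (fun t => f (Function.update U b (k t * U b))) (f' U) 0)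
    (A' : GaugeField P 0 G → ℝ) (hA'm : Measurable A') {CA' : ℝ} (hCA' : ∀ U, |A' U| ≤ CA')
    (hA' : ∀ U, HasDerivAt (fun t => wilsonAction4 (Function.update U b (k t * U b))) (A' U) 0) :
    ∫ U, f' U ∂gibbsMeasure P β = β * ∫ U, f U * A' U ∂gibbsMeasure P β := by
  haveI := isProbabilityMeasure_gibbsMeasure (G := G) P hβ
  set μ := gibbsMeasure (G := G) P β with hμ
  set S : GaugeField P 0 G → ℝ := fun U => wilsonAction4 U with hSdef
  set T : ℝ → GaugeField P 0 G → GaugeField P 0 G := fun t U => Function.update U b (k t * U b) with hT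
  have hflow : ∀ s t U, T (t + s) U = T t (T s U) := fun s t U => update_mul_flow hk b s t U
  have hT0 : ∀ U, T 0 U = U := fun U => update_mul_zero hk b U
  have hTm : ∀ t, Measurable (T t) := fun t => measurable_update_mul b (k t)
  have hf'T : ∀ U, HasDerivAt (fun t => f (T t U)) (f' U) 0 := hf'
  have hS'T : ∀ U, HasDerivAt (fun t => S (T t U)) (A' U) 0 := hA'
  have hCf0 : 0 ≤ Cf := (abs_nonneg _).trans (hCf (fun _ => 1))
  have hSm : Measurable S := measurable_wilsonAction4 RegularGaugeGroup.measurable_reTr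
  set CS : ℝ := 2 * (Fintype.card (Plaq P 0) : ℝ) with hCSdef
  have hCS : ∀ U, |S U| ≤ CS := fun U => abs_wilsonAction4_le U
  -- the two sides of the finite-shift identity, as functions of `t`
  have hAB : ∀ t : ℝ, ∫ U, f (T t U) ∂μ = ∫ U, f U * Real.exp (-(β * (S (T (-t) U) - S U))) ∂μ := by
    intro t
    have h := integral_comp_update_mul_gibbsMeasure (P := P) hβ b (k t) f
    have hneg : (k t)⁻¹ = k (-t) := by
      have h0 : k 0 = 1 := by
        have h' := hk 0 0
        rw [add_zero] at h'
        exact mul_eq_left.1 h'.symm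
      have h1 : k (-t) * k t = 1 := by rw [← hk, neg_add_cancel, h0]
      exact inv_eq_of_mul_eq_one_left h1
    rw [hneg] at h
    exact h
  -- derivative of the left side
  have hAd : HasDerivAt (fun t : ℝ => ∫ U, f (T t U) ∂μ) (∫ U, f' U ∂μ) 0 := by
    refine hasDerivAt_integral_of_bounded_lipschitz μ (fun t U => f (T t U)) f' (Cf + Cf')
      (fun t => hfm.comp (hTm t)) hf'm
      (fun t U => (hCf _).trans (le_add_of_nonneg_right ?_)) (fun U t s => ?_) hf'T
    · exact (abs_nonneg _).trans (hCf' U)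
    · calc |f (T t U) - f (T s U)| ≤ Cf' * |t - s| := lipschitz_of_flow T hflow f f' hf'T hCf' U t s
        _ ≤ (Cf + Cf') * |t - s| := by gcongr; linarith
  -- derivative of the right side
  have hBd : HasDerivAt (fun t : ℝ => ∫ U, f U * Real.exp (-(β * (S (T (-t) U) - S U))) ∂μ)
      (∫ U, f U * (β * A' U) ∂μ) 0 := by
    set M := |β| * (2 * CS) with hMdef
    have hM : ∀ t U, -(β * (S (T (-t) U) - S U)) ≤ M := fun t U => by
      have h1 := hCS (T (-t) U)
      have h2 := hCS U
      calc -(β * (S (T (-t) U) - S U)) ≤ |β * (S (T (-t) U) - S U)| := neg_le_abs _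
        _ = |β| * |S (T (-t) U) - S U| := abs_mul _ _
        _ ≤ |β| * (2 * CS) := by
            gcongr
            calc |S (T (-t) U) - S U| ≤ |S (T (-t) U)| + |S U| := abs_sub _ _
              _ ≤ CS + CS := add_le_add h1 h2
              _ = 2 * CS := by ring
    have hE : ∀ t U, |Real.exp (-(β * (S (T (-t) U) - S U)))| ≤ Real.exp M := fun t U => by
      rw [abs_of_pos (Real.exp_pos _)]
      exact Real.exp_le_exp.2 (hM t U)
    have hSlip : ∀ U t s, |S (T (-t) U) - S (T (-s) U)| ≤ CA' * |t - s| := fun U t s => by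
      have h := lipschitz_of_flow T hflow S A' hS'T hCA' U (-t) (-s)
      rwa [show |(-t) - (-s)| = |t - s| by rw [neg_sub_neg, abs_sub_comm]] at h
    refine hasDerivAt_integral_of_bounded_lipschitz μ
      (fun t U => f U * Real.exp (-(β * (S (T (-t) U) - S U)))) (fun U => f U * (β * A' U))
      (Cf * Real.exp M + Cf * (Real.exp M * (|β| * CA'))) (fun t => ?_) ?_ (fun t U => ?_)
      (fun U t s => ?_) (fun U => ?_)
    · exact hfm.mul (((((hSm.comp (hTm (-t))).sub hSm).const_mul β).neg).exp)
    · exact hfm.mul (hA'm.const_mul β)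
    · calc |f U * Real.exp (-(β * (S (T (-t) U) - S U)))|
          = |f U| * |Real.exp (-(β * (S (T (-t) U) - S U)))| := abs_mul _ _
        _ ≤ Cf * Real.exp M := mul_le_mul (hCf U) (hE t U) (abs_nonneg _) hCf0
        _ ≤ Cf * Real.exp M + Cf * (Real.exp M * (|β| * CA')) := le_add_of_nonneg_right (by
            have : 0 ≤ CA' := (abs_nonneg _).trans (hCA' U)
            positivity)
    · have hx : -(β * (S (T (-t) U) - S U)) ≤ M := hM t U
      have hy : -(β * (S (T (-s) U) - S U)) ≤ M := hM s U
      have hCA'0 : 0 ≤ CA' := (abs_nonneg _).trans (hCA' U)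
      calc |f U * Real.exp (-(β * (S (T (-t) U) - S U))) - f U * Real.exp (-(β * (S (T (-s) U) - S U)))|
          = |f U| * |Real.exp (-(β * (S (T (-t) U) - S U))) - Real.exp (-(β * (S (T (-s) U) - S U)))| := by
            rw [← mul_sub, abs_mul]
        _ ≤ Cf * (Real.exp M * |(-(β * (S (T (-t) U) - S U))) - (-(β * (S (T (-s) U) - S U)))|) :=
            mul_le_mul (hCf U) (abs_exp_sub_exp_le hx hy) (abs_nonneg _) hCf0
        _ = Cf * (Real.exp M * (|β| * |S (T (-t) U) - S (T (-s) U)|)) := by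
            rw [show -(β * (S (T (-t) U) - S U)) - -(β * (S (T (-s) U) - S U)) =
              -(β * (S (T (-t) U) - S (T (-s) U))) by ring, abs_neg, abs_mul]
        _ ≤ Cf * (Real.exp M * (|β| * (CA' * |t - s|))) := by gcongr; exact hSlip U t s
        _ = Cf * (Real.exp M * (|β| * CA')) * |t - s| := by ring
        _ ≤ (Cf * Real.exp M + Cf * (Real.exp M * (|β| * CA'))) * |t - s| := by
            have : 0 ≤ Cf * Real.exp M * |t - s| := by positivity
            nlinarith [this]
    · have hSneg : HasDerivAt (fun t : ℝ => S (T (-t) U)) (-(A' U)) 0 := by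
        have h0 : HasDerivAt (fun t : ℝ => S (T t U)) (A' U) (-0) := by rw [neg_zero]; exact hS'T U
        have h := h0.scomp (0 : ℝ) (hasDerivAt_neg (0 : ℝ))
        simpa [Function.comp_def] using h
      have hin : HasDerivAt (fun t : ℝ => -(β * (S (T (-t) U) - S U))) (β * A' U) 0 := by
        exact (((hSneg.sub_const (S U)).const_mul β).neg).congr_deriv (by ring)
      have hexp := hin.exp
      have h0 : -(β * (S (T (-0) U) - S U)) = 0 := by rw [neg_zero, hT0, sub_self, mul_zero, neg_zero]
      rw [h0, Real.exp_zero, one_mul] at hexp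
      exact hexp.const_mul (f U)
  -- the two sides agree, hence so do their derivatives
  have hEq : (fun t : ℝ => ∫ U, f (T t U) ∂μ) =
      fun t : ℝ => ∫ U, f U * Real.exp (-(β * (S (T (-t) U) - S U))) ∂μ := funext hAB
  rw [hEq] at hAd
  rw [hAd.unique hBd, ← integral_const_mul]
  refine integral_congr_ae (ae_of_all _ fun U => ?_)
  ring

end Finest

end Summit.QuantumFields.YangMills.Theorems.UnitScaleGibbsOneBondSchwingerDyson

end
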